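import Literature.Probability.Distributions.PseudoGaussianSamplerTV
import Mathlib.Analysis.SpecialFunctions.Log.Base
import HarnessLib

/-!
# Parameters for the pseudo-Gaussian sampler at dyadic precision `2^{-m}`

Topic `Probability/Distributions`, sequel of `PseudoGaussianSamplerTV.lean`
(`PGParams.tvDist_lawPMF_gaussBoxPMF_le`: the coin-driven sampler with parameters `P = (b, r, k, J)` is
within statistical distance `(e^{hR + 2qR² + q}(1 + h)/(1 - p₀^J) - 1) + 2e^{-(R - h/2)²}` of the rounded
Gaussian `ℓ_b`, `h = 2^{-b}`, `R = 2^r`, `q = 2^{-k}`). A machine that needs the sampler to precision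
`2^{-m}` must CHOOSE `r, k, J` (the mesh exponent `b` being dictated by the width it wants, as long as
it is large) and know that the bound is then `≤ 8 · 2^{-m}`, with all parameters polynomial in `m`
(so that the coins read, `J · (r + b + 1 + 2^{2r+k} k)` per sample, are polynomially many). This file
makes one such choice and proves the bound (elementary real arithmetic; `e < 2.72`, `ln 2 < 0.7`):

* `PGParams.rOf m = ⌊log₂(m+1)⌋ + 1` (`m + 1 < R ≤ 2(m+1)`), `kOf m = m + 2·rOf m + 3`
  (`q = 2^{-m-3}/R²`), `JOf m = 8 R (m+1)` (`p₀^J ≤ e^{-8(m+1)e⁻²} ≤ 2^{-(m+1)}`), and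
  `PGParams.std m b = ⟨b, rOf m, kOf m, JOf m⟩`;
* `R_std`, `lt_R_std`, `R_std_le`, `one_le_k_std`, `one_le_r_std`, `pNone_pow_J_std_le`
  (`p₀^J ≤ 2^{-(m+1)}`), `pNone_pow_J_std_lt_one`;
* **`PGParams.errorBound_std_le`** — for `1 ≤ m` and `m + rOf m + 1 ≤ b`:
  `(e^{hR + 2qR² + q}(1 + h)/(1 - p₀^J) - 1) + 2e^{-(R - h/2)²} ≤ 8 · 2^{-m}` at `P = std m b`;
* **`PGParams.tvDist_lawPMF_std_gaussBoxPMF_le`** — hence `Δ(ℓ'_{std m b}, ℓ_b) ≤ 8 · 2^{-m}`.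

All proved; definitions with bodies; no named fact.

## References

* S. Aaronson, A. Arkhipov, *The computational complexity of linear optics*, Theory of Computing 9
  (2013) 143–252, §5.2 (parameters of the hiding procedure polynomial in the precision)
  [AaronsonArkhipov2013].
* C. Peikert, *Public-key cryptosystems from the worst-case shortest vector problem*, STOC 2009,
  proof of Thm. 3.1 (the consumer) [Peikert2009].
-/

noncomputable section

namespace Literature.Probability.Distributions

open Real

namespace PGParams

/-! ### The choice of parameters -/

/-- Range exponent at precision `m`: `R = 2^{rOf m}` with `m + 1 < R ≤ 2(m + 1)`. [folklore] -/
def rOf (m : ℕ) : ℕ := Nat.log 2 (m + 1) + 1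

/-- Acceptance-granularity exponent at precision `m`: `q = 2^{-kOf m} = 2^{-(m+3)}/R²`. [folklore] -/
def kOf (m : ℕ) : ℕ := m + 2 * rOf m + 3

/-- Number of attempts at precision `m`: `J = 8R(m+1)`. [folklore] -/
def JOf (m : ℕ) : ℕ := 8 * 2 ^ rOf m * (m + 1)

/-- **The standard parameters at precision `m` and mesh exponent `b`.** [folklore] -/
def std (m b : ℕ) : PGParams := ⟨b, rOf m, kOf m, JOf m⟩

variable (m b : ℕ)

/-- Field of `std`. [folklore] -/
@[simp] theorem std_b : (std m b).b = b := rfl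
/-- Field of `std`. [folklore] -/
@[simp] theorem std_r : (std m b).r = rOf m := rfl
/-- Field of `std`. [folklore] -/
@[simp] theorem std_k : (std m b).k = kOf m := rfl
/-- Field of `std`. [folklore] -/
@[simp] theorem std_J : (std m b).J = JOf m := rfl

/-- `R = 2^{rOf m}`. [folklore] -/
theorem R_std : (std m b).R = (2 : ℝ) ^ rOf m := rfl

/-- `m + 1 < R`. [folklore] -/
theorem lt_R_std : (m : ℝ) + 1 < (std m b).R := by
  rw [R_std, rOf]
  have h := Nat.lt_pow_succ_log_self (b := 2) one_lt_two (m + 1)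
  exact_mod_cast h

/-- `R ≤ 2(m + 1)`. [folklore] -/
theorem R_std_le : (std m b).R ≤ 2 * ((m : ℝ) + 1) := by
  rw [R_std, rOf, pow_succ]
  have h := Nat.pow_log_le_self 2 (x := m + 1) (Nat.succ_ne_zero m)
  have h' : ((2 : ℕ) ^ Nat.log 2 (m + 1) : ℝ) ≤ (m : ℝ) + 1 := by exact_mod_cast h
  push_cast at h'
  linarith

/-- `1 ≤ r`. [folklore] -/
theorem one_le_r_std : 1 ≤ (std m b).r := by simp [rOf]

/-- `1 ≤ k`. [folklore] -/
theorem one_le_k_std : 1 ≤ (std m b).k := by simp [kOf]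

/-- `h = 2^{-b}`, `q = 2^{-k}` (unfoldings at `std`). [folklore] -/
theorem h_std : (std m b).h = ((2 : ℝ) ^ b)⁻¹ := rfl

/-- `q = 2^{-(m + 2r + 3)}`. [folklore] -/
theorem q_std : (std m b).q = ((2 : ℝ) ^ (m + 2 * rOf m + 3))⁻¹ := rfl

/-- `q R² = 2^{-(m+3)}`. [folklore] -/
theorem q_mul_R_sq_std : (std m b).q * (std m b).R ^ 2 = ((2 : ℝ) ^ (m + 3))⁻¹ := by
  rw [q_std, R_std, ← pow_mul, show m + 2 * rOf m + 3 = (m + 3) + rOf m * 2 by ring, pow_add, mul_inv,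
    mul_assoc, inv_mul_cancel₀ (by positivity), mul_one]

/-- `h R ≤ 2^{-(m+1)}` when `b ≥ m + r + 1`. [folklore] -/
theorem h_mul_R_std_le (hb : m + rOf m + 1 ≤ b) : (std m b).h * (std m b).R ≤ ((2 : ℝ) ^ (m + 1))⁻¹ := by
  rw [h_std, R_std]
  have hpow : (2 : ℝ) ^ (m + 1) * 2 ^ rOf m ≤ 2 ^ b := by
    rw [← pow_add]
    exact pow_le_pow_right₀ (by norm_num) (by omega)
  have h2b : (0 : ℝ) < 2 ^ b := by positivity
  have h2m : (0 : ℝ) < 2 ^ (m + 1) := by positivity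
  rw [inv_mul_le_iff₀ h2b, ← div_eq_mul_inv, le_div_iff₀ h2m, mul_comm]
  exact hpow

/-- `h ≤ 2^{-(m+1)}` when `b ≥ m + r + 1`. [folklore] -/
theorem h_std_le (hb : m + rOf m + 1 ≤ b) : (std m b).h ≤ ((2 : ℝ) ^ (m + 1))⁻¹ := by
  rw [h_std]
  exact inv_anti₀ (by positivity) (pow_le_pow_right₀ (by norm_num) (by omega))

/-! ### The failure probability of all attempts -/

/-- `e⁻² ≥ 0.135`. [folklore] -/
theorem exp_neg_two_ge : (0.135 : ℝ) ≤ exp (-2) := by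
  have h1 : exp (2 : ℝ) = exp 1 ^ 2 := by rw [← Real.exp_nat_mul]; norm_num
  have h2 : exp (2 : ℝ) < 7.39 := by
    rw [h1]
    have := Real.exp_one_lt_d9
    have h0 : 0 < exp (1 : ℝ) := exp_pos 1
    nlinarith
  rw [Real.exp_neg, le_inv_comm₀ (by norm_num) (exp_pos 2)]
  linarith

/-- **`p₀^J ≤ 2^{-(m+1)}`** at the standard parameters (`p₀^J ≤ e^{-Je⁻²/R} = e^{-8(m+1)e⁻²}` and
`8e⁻² ≥ 1.08 ≥ ln 2`). [folklore] -/
theorem pNone_pow_J_std_le : (std m b).pNone ^ (std m b).J ≤ ((2 : ℝ) ^ (m + 1))⁻¹ := by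
  have h := (std m b).pNone_pow_le (one_le_k_std m b) (one_le_r_std m b)
  refine h.trans ?_
  have hJR : ((std m b).J : ℝ) * exp (-2) / (std m b).R = 8 * ((m : ℝ) + 1) * exp (-2) := by
    rw [std_J, JOf, R_std]
    push_cast
    field_simp
  rw [hJR]
  have hlog := Real.log_two_lt_d9
  have he := exp_neg_two_ge
  have htwo : ((2 : ℝ) ^ (m + 1))⁻¹ = exp (-(((m : ℝ) + 1) * Real.log 2)) := by
    rw [Real.exp_neg, ← Real.exp_log (by positivity : (0 : ℝ) < 2 ^ (m + 1)), Real.log_pow]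
    push_cast
    ring_nf
  rw [htwo, Real.exp_le_exp]
  have hm : (0 : ℝ) ≤ m := Nat.cast_nonneg m
  nlinarith

/-- `p₀^J < 1`. [folklore] -/
theorem pNone_pow_J_std_lt_one : (std m b).pNone ^ (std m b).J < 1 := by
  refine (pNone_pow_J_std_le m b).trans_lt ?_
  rw [inv_lt_one_iff₀]
  right
  exact one_lt_pow₀ (by norm_num) (by omega)

/-! ### The error bound -/

/-- `e^x ≤ 1 + 2x` for `0 ≤ x ≤ 1`. [folklore] -/
theorem exp_le_one_add_two_mul {x : ℝ} (h0 : 0 ≤ x) (h1 : x ≤ 1) : exp x ≤ 1 + 2 * x := by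
  have h := Real.abs_exp_sub_one_sub_id_le (by rw [abs_of_nonneg h0]; exact h1)
  rw [abs_le] at h
  nlinarith

/-- **The error bound of the standard parameters**: for `1 ≤ m` and `m + rOf m + 1 ≤ b`,
`(e^{hR + 2qR² + q}(1 + h)/(1 - p₀^J) - 1) + 2e^{-(R - h/2)²} ≤ 8 · 2^{-m}` at `P = std m b`
(`hR, h, p₀^J ≤ 2^{-(m+1)}`, `qR², q ≤ 2^{-(m+3)}`, `R - h/2 ≥ m + ½`). [folklore] -/
theorem errorBound_std_le (hm : 1 ≤ m) (hb : m + rOf m + 1 ≤ b) :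
    (exp ((std m b).h * (std m b).R + 2 * (std m b).q * (std m b).R ^ 2 + (std m b).q) * (1 + (std m b).h) /
        (1 - (std m b).pNone ^ (std m b).J) - 1) +
      2 * exp (-((std m b).R - (std m b).h / 2) ^ 2) ≤ 8 * ((2 : ℝ) ^ m)⁻¹ := by
  set P := std m b with hP
  set ε : ℝ := ((2 : ℝ) ^ m)⁻¹ with hε
  have hε0 : 0 < ε := by rw [hε]; positivity
  have hε1 : ε ≤ 1 / 2 := by
    rw [hε, one_div]
    exact inv_anti₀ (by norm_num) (by
      calc (2 : ℝ) = 2 ^ 1 := by norm_num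
        _ ≤ 2 ^ m := pow_le_pow_right₀ (by norm_num) hm)
  have hε2 : ((2 : ℝ) ^ (m + 1))⁻¹ = ε / 2 := by rw [hε, pow_succ, mul_inv]; ring
  have hε8 : ((2 : ℝ) ^ (m + 3))⁻¹ = ε / 8 := by rw [hε, pow_add, mul_inv]; ring
  -- the small quantities
  have hh0 : 0 < P.h := P.h_pos
  have hq0 : 0 < P.q := P.q_pos
  have hR0 : 0 < P.R := by rw [hP, R_std]; positivity
  have hhR : P.h * P.R ≤ ε / 2 := by rw [← hε2]; exact h_mul_R_std_le m b hb
  have hh : P.h ≤ ε / 2 := by rw [← hε2]; exact h_std_le m b hb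
  have hqR : P.q * P.R ^ 2 = ε / 8 := by rw [← hε8]; exact q_mul_R_sq_std m b
  have hq : P.q ≤ ε / 8 := by
    rw [← hqR]
    refine le_mul_of_one_le_right hq0.le ?_
    have : (1 : ℝ) < P.R := by have := lt_R_std m b; rw [← hP] at this; linarith
    nlinarith
  have hp : P.pNone ^ P.J ≤ ε / 2 := by rw [← hε2]; exact pNone_pow_J_std_le m b
  have hp0 : 0 ≤ P.pNone ^ P.J := pow_nonneg P.pNone_nonneg _
  -- (1) the exponential factor
  set x : ℝ := P.h * P.R + 2 * P.q * P.R ^ 2 + P.q with hx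
  have hx0 : 0 ≤ x := by rw [hx]; positivity
  have hxε : x ≤ ε := by rw [hx]; nlinarith
  have hex : exp x ≤ 1 + 2 * ε := (exp_le_one_add_two_mul hx0 (by linarith)).trans (by linarith)
  -- (2) the factor `1/(1 - p)`
  have hden : 0 < 1 - P.pNone ^ P.J := by linarith
  have hF : exp x * (1 + P.h) / (1 - P.pNone ^ P.J) ≤ (1 + 2 * ε) * (1 + ε / 2) * (1 + ε) := by
    rw [div_le_iff₀ hden]
    have h1 : exp x * (1 + P.h) ≤ (1 + 2 * ε) * (1 + ε / 2) :=
      mul_le_mul hex (by linarith) (by linarith) (by linarith)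
    have h2 : (1 + 2 * ε) * (1 + ε / 2) ≤ (1 + 2 * ε) * (1 + ε / 2) * (1 + ε) * (1 - P.pNone ^ P.J) := by
      have hA : 0 ≤ (1 + 2 * ε) * (1 + ε / 2) := by positivity
      have hB : 1 ≤ (1 + ε) * (1 - P.pNone ^ P.J) := by nlinarith
      calc (1 + 2 * ε) * (1 + ε / 2) = (1 + 2 * ε) * (1 + ε / 2) * 1 := by ring
        _ ≤ (1 + 2 * ε) * (1 + ε / 2) * ((1 + ε) * (1 - P.pNone ^ P.J)) :=
            mul_le_mul_of_nonneg_left hB hA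
        _ = (1 + 2 * ε) * (1 + ε / 2) * (1 + ε) * (1 - P.pNone ^ P.J) := by ring
    exact h1.trans h2
  have hF' : (1 + 2 * ε) * (1 + ε / 2) * (1 + ε) ≤ 1 + 6 * ε := by
    have h3 : ε ^ 2 ≤ ε / 2 := by nlinarith
    have h4 : ε ^ 3 ≤ ε / 4 := by nlinarith
    nlinarith
  -- (3) the tail
  have htail : exp (-(P.R - P.h / 2) ^ 2) ≤ ε := by
    have hRm : (m : ℝ) + 1 / 2 ≤ P.R - P.h / 2 := by
      have h1 := lt_R_std m b
      rw [← hP] at h1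
      have : P.h ≤ 1 := P.h_le_one
      linarith
    have hm0 : (0 : ℝ) ≤ m := Nat.cast_nonneg m
    have hsq : (m : ℝ) * Real.log 2 ≤ (P.R - P.h / 2) ^ 2 := by
      have hlog := Real.log_two_lt_d9
      have h2 : ((m : ℝ) + 1 / 2) ^ 2 ≤ (P.R - P.h / 2) ^ 2 := pow_le_pow_left₀ (by linarith) hRm 2
      nlinarith
    have htwo : ε = exp (-((m : ℝ) * Real.log 2)) := by
      rw [hε, Real.exp_neg, ← Real.exp_log (by positivity : (0 : ℝ) < 2 ^ m), Real.log_pow]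
    rw [htwo, Real.exp_le_exp]
    linarith
  -- assemble
  have : exp x * (1 + P.h) / (1 - P.pNone ^ P.J) - 1 ≤ 6 * ε := by linarith
  linarith

/-- **The standard sampler is within `8 · 2^{-m}` of the rounded Gaussian `ℓ_b`** in statistical
distance (`1 ≤ m`, `m + rOf m + 1 ≤ b`). [folklore] -/
theorem tvDist_lawPMF_std_gaussBoxPMF_le (hm : 1 ≤ m) (hb : m + rOf m + 1 ≤ b) :
    (std m b).lawPMF.tvDist (gaussBoxPMF b) ≤ 8 * ((2 : ℝ) ^ m)⁻¹ :=
  ((std m b).tvDist_lawPMF_gaussBoxPMF_le (one_le_k_std m b) (pNone_pow_J_std_lt_one m b)).trans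
    (errorBound_std_le m b hm hb)

end PGParams

end Literature.Probability.Distributions

end
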